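import Summits.HubbardSuperconductivity.HubbardSuperconductivity.Theorems.AnisotropyChordTransferFibre3FinXB2Sym

/-!
# Route `AnisotropyChord` / H0 rotor rung: FIN mid-`L` evaluator XB2 — soundness of the two-propagator cell table

Soundness layer 1b of `…Fibre3FinXB2Eval`: the cell table `tTab2 L (tWedgePt L la) (tWedgePt L lb)` encloses
`T(k) = Σ_p g(p) g(p − k)` for every `λ` of the cell `λ·D ∈ [la, lb]` (★★ `mem_tTab2`, the XB2 analogue of g5's `mem_tTab`):
point ends on the cell (`gPt_lo`, `gPt_hi`), the row-pair correlation `rowCorr` bounds (`rowCorr_lower/upper`, via `dotP_*` and the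
rotated-row lookup), the involution-weighted accumulation `tSumP` bounds (`tSumP_lower/upper`), the weighted sum is `T`
(`sum_wRow_eq_Tsum`, via `sum_invol_weight` and `rowT_invol`), one outward rounding (`mem_tEntryP`), wedge / cell-table lookups.
Prover seat `hubbard-h0-rotor-p3` g6; helper for piece A = stmt-HubbardSuperconductivity-23918 of rung 19089 (`--supports`, helper
class).  WHAT THIS IS NOT: nothing here proves superconductivity in the Hubbard model (rotor TARGET as worded stays FALSE, g15 verdict);
soundness lemmas for the FIN certificates of ONE conditional reduction.  Tree imports only; no sorry, no new axioms.
-/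

set_option linter.dupNamespace false
set_option autoImplicit false

namespace Summit.HubbardSuperconductivity.HubbardSuperconductivity.Theorems.AnisotropyChord.Transfer.Fibre3

namespace FinXB

open scoped BigOperators
open Finset Hole2 FinCell

variable (L : ℕ) [NeZero L]

/-! ## The row-pair correlation and the weighted sum on a cell -/

section cell

variable {L}
variable {lam : ℝ} {la lb : ℤ}

/-- `g` at natural coordinates. -/
noncomputable def xg (lam : ℝ) (i j : ℕ) : ℝ := gres L lam (((i : ℕ) : ZMod L), ((j : ℕ) : ZMod L))

/-- the natural-coordinate row sum `Σ_{p₂<L} g(p₁,p₂) g(s, p₂ − k₂)`. -/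
noncomputable def rowN (lam : ℝ) (p1 s k2 : ℕ) : ℝ := ∑ p2 ∈ range L, xg (L := L) lam p1 p2 * xg (L := L) lam s (subm L p2 k2)

/-- lower point ends: nonnegative and below `g·D` on the cell. [folklore] -/
theorem gPt_lo (hL : 3 ≤ L) (hla : (la : ℝ) ≤ lam * ((D : ℤ) : ℝ)) (hlb : lam * ((D : ℤ) : ℝ) ≤ (lb : ℝ))
    (hpos : denCellPos L (cosTab L) la lb = true) (hna : gPtNonneg L la = true) {i j : ℕ} (hi : i < L) (hj : j < L) :
    0 ≤ (((gAt (gresCellTab L (cosTab L) la la) i j).1 : ℤ) : ℝ) ∧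
      (((gAt (gresCellTab L (cosTab L) la la) i j).1 : ℤ) : ℝ) ≤ xg (L := L) lam i j * ((D : ℤ) : ℝ) := by
  refine ⟨by exact_mod_cast gPtNonneg_spec L hna hi hj, ?_⟩
  have h := (mem_gAt L hL hla hlb hpos hi hj).1
  rw [gAt_cell_split L (cosTab L) la lb hi hj] at h
  exact h

/-- upper point ends: `0 ≤ g·D ≤` the upper end at `lb` on the cell. [folklore] -/
theorem gPt_hi (hL : 3 ≤ L) (hla : (la : ℝ) ≤ lam * ((D : ℤ) : ℝ)) (hlb : lam * ((D : ℤ) : ℝ) ≤ (lb : ℝ))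
    (hpos : denCellPos L (cosTab L) la lb = true) (hna : gPtNonneg L la = true) {i j : ℕ} (hi : i < L) (hj : j < L) :
    0 ≤ xg (L := L) lam i j * ((D : ℤ) : ℝ) ∧
      xg (L := L) lam i j * ((D : ℤ) : ℝ) ≤ (((gAt (gresCellTab L (cosTab L) lb lb) i j).2 : ℤ) : ℝ) := by
  have hlo := gPt_lo hL hla hlb hpos hna hi hj
  have h := (mem_gAt L hL hla hlb hpos hi hj).2
  rw [gAt_cell_split L (cosTab L) la lb hi hj] at h
  exact ⟨hlo.1.trans hlo.2, h⟩

/-- ★ lower bound of the row-pair correlation at `la`. [folklore] -/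
theorem rowCorr_lower (hL : 3 ≤ L) (hla : (la : ℝ) ≤ lam * ((D : ℤ) : ℝ)) (hlb : lam * ((D : ℤ) : ℝ) ≤ (lb : ℝ))
    (hpos : denCellPos L (cosTab L) la lb = true) (hna : gPtNonneg L la = true)
    {p1 s k2 : ℕ} (hp1 : p1 < L) (hs : s < L) (hk2 : k2 < L) (acc : ℤ × ℤ) :
    (((rowCorr L (gPt L la) p1 s k2 acc).1 : ℤ) : ℝ)
      ≤ (acc.1 : ℝ) + rowN (L := L) lam p1 s k2 * ((D : ℤ) : ℝ) * ((D : ℤ) : ℝ) := by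
  unfold rowCorr rowN
  rw [gPt_row L la hp1, gPt_row L la hs]
  have hl1 : ((List.range L).map (gAt (gresCellTab L (cosTab L) la la) p1)).length = L := by simp
  have hl2 : (((List.range L).map (gAt (gresCellTab L (cosTab L) la la) s)).rotate (L - k2)).length = L := by simp
  have h := dotP_lower ((List.range L).map (gAt (gresCellTab L (cosTab L) la la) p1))
    (((List.range L).map (gAt (gresCellTab L (cosTab L) la la) s)).rotate (L - k2))
    (fun p2 => xg (L := L) lam p1 p2) (fun p2 => xg (L := L) lam s (subm L p2 k2)) acc (by rw [hl1, hl2])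
    (fun j hj => by
      rw [hl1] at hj
      unfold getIv
      rw [getD_map_range _ _ hj]
      exact gPt_lo hL hla hlb hpos hna hp1 hj)
    (fun j hj => by
      rw [hl2] at hj
      rw [getIv_rotate_row _ hk2 hj]
      exact gPt_lo hL hla hlb hpos hna hs (subm_lt L j k2 (by omega)))
  rw [hl1] at h
  exact h

/-- ★ upper bound of the row-pair correlation at `lb`. [folklore] -/
theorem rowCorr_upper (hL : 3 ≤ L) (hla : (la : ℝ) ≤ lam * ((D : ℤ) : ℝ)) (hlb : lam * ((D : ℤ) : ℝ) ≤ (lb : ℝ))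
    (hpos : denCellPos L (cosTab L) la lb = true) (hna : gPtNonneg L la = true)
    {p1 s k2 : ℕ} (hp1 : p1 < L) (hs : s < L) (hk2 : k2 < L) (acc : ℤ × ℤ) :
    (acc.2 : ℝ) + rowN (L := L) lam p1 s k2 * ((D : ℤ) : ℝ) * ((D : ℤ) : ℝ)
      ≤ (((rowCorr L (gPt L lb) p1 s k2 acc).2 : ℤ) : ℝ) := by
  unfold rowCorr rowN
  rw [gPt_row L lb hp1, gPt_row L lb hs]
  have hl1 : ((List.range L).map (gAt (gresCellTab L (cosTab L) lb lb) p1)).length = L := by simp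
  have hl2 : (((List.range L).map (gAt (gresCellTab L (cosTab L) lb lb) s)).rotate (L - k2)).length = L := by simp
  have h := dotP_upper ((List.range L).map (gAt (gresCellTab L (cosTab L) lb lb) p1))
    (((List.range L).map (gAt (gresCellTab L (cosTab L) lb lb) s)).rotate (L - k2))
    (fun p2 => xg (L := L) lam p1 p2) (fun p2 => xg (L := L) lam s (subm L p2 k2)) acc (by rw [hl1, hl2])
    (fun j hj => by
      rw [hl1] at hj
      unfold getIv
      rw [getD_map_range _ _ hj]
      exact gPt_hi hL hla hlb hpos hna hp1 hj)
    (fun j hj => by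
      rw [hl2] at hj
      rw [getIv_rotate_row _ hk2 hj]
      exact gPt_hi hL hla hlb hpos hna hs (subm_lt L j k2 (by omega)))
  rw [hl1] at h
  exact h

/-- the weight of the involution at `p₁` applied to the row sum of `(p₁, p₁ − k₁)`. -/
noncomputable def wRow (lam : ℝ) (k1 k2 p1 : ℕ) : ℝ :=
  if p1 < (k1 + L - p1) % L then 2 * rowN (L := L) lam p1 ((p1 + L - k1) % L) k2
  else if p1 = (k1 + L - p1) % L then rowN (L := L) lam p1 ((p1 + L - k1) % L) k2 else 0

/-- the row sums are nonnegative. [folklore] -/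
theorem rowN_nonneg (hL : 3 ≤ L) (hla : (la : ℝ) ≤ lam * ((D : ℤ) : ℝ)) (hlb : lam * ((D : ℤ) : ℝ) ≤ (lb : ℝ))
    (hpos : denCellPos L (cosTab L) la lb = true) (hna : gPtNonneg L la = true)
    {p1 s : ℕ} (hp1 : p1 < L) (hs : s < L) (k2 : ℕ) : 0 ≤ rowN (L := L) lam p1 s k2 := by
  unfold rowN
  refine Finset.sum_nonneg fun p2 hp2 => ?_
  rw [mem_range] at hp2
  have hD := D_pos
  have h1 := (gPt_hi hL hla hlb hpos hna hp1 hp2).1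
  have h2 := (gPt_hi hL hla hlb hpos hna hs (subm_lt L p2 k2 (by omega))).1
  have a1 : 0 ≤ xg (L := L) lam p1 p2 := nonneg_of_mul_nonneg_left h1 hD
  have a2 : 0 ≤ xg (L := L) lam s (subm L p2 k2) := nonneg_of_mul_nonneg_left h2 hD
  exact mul_nonneg a1 a2

/-- ★ lower bound of the weighted accumulation at `la`. [folklore] -/
theorem tSumP_lower (hL : 3 ≤ L) (hla : (la : ℝ) ≤ lam * ((D : ℤ) : ℝ)) (hlb : lam * ((D : ℤ) : ℝ) ≤ (lb : ℝ))
    (hpos : denCellPos L (cosTab L) la lb = true) (hna : gPtNonneg L la = true)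
    {k1 k2 : ℕ} (hk1 : k1 < L) (hk2 : k2 < L) :
    ∀ n : ℕ, n ≤ L → (((tSumP L (gPt L la) k1 k2 n).1 : ℤ) : ℝ)
      ≤ (∑ p1 ∈ range n, wRow (L := L) lam k1 k2 p1) * ((D : ℤ) : ℝ) * ((D : ℤ) : ℝ)
  | 0, _ => by simp [tSumP]
  | n + 1, hn => by
      have ih := tSumP_lower hL hla hlb hpos hna hk1 hk2 n (by omega)
      have hnL : n < L := by omega
      have hsL : (n + L - k1) % L < L := Nat.mod_lt _ (by omega)
      rw [Finset.sum_range_succ]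
      by_cases h1 : n < (k1 + L - n) % L
      · have hw : wRow (L := L) lam k1 k2 n = 2 * rowN (L := L) lam n ((n + L - k1) % L) k2 := by
          unfold wRow; rw [if_pos h1]
        have ht : tSumP L (gPt L la) k1 k2 (n + 1)
            = ((tSumP L (gPt L la) k1 k2 n).1 + 2 * (rowCorr L (gPt L la) n ((n + L - k1) % L) k2 (0, 0)).1,
               (tSumP L (gPt L la) k1 k2 n).2 + 2 * (rowCorr L (gPt L la) n ((n + L - k1) % L) k2 (0, 0)).2) := by
          simp only [tSumP]; rw [if_pos h1]
        have hr := rowCorr_lower hL hla hlb hpos hna hnL hsL hk2 ((0 : ℤ), (0 : ℤ))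
        rw [hw, ht]
        push_cast at hr ih ⊢
        nlinarith [hr, ih]
      · by_cases h2 : n = (k1 + L - n) % L
        · have hw : wRow (L := L) lam k1 k2 n = rowN (L := L) lam n ((n + L - k1) % L) k2 := by
            unfold wRow; rw [if_neg h1, if_pos h2]
          have ht : tSumP L (gPt L la) k1 k2 (n + 1)
              = rowCorr L (gPt L la) n ((n + L - k1) % L) k2 (tSumP L (gPt L la) k1 k2 n) := by
            simp only [tSumP]; rw [if_neg h1, if_pos h2]
          have hr := rowCorr_lower hL hla hlb hpos hna hnL hsL hk2 (tSumP L (gPt L la) k1 k2 n)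
          rw [hw, ht]
          nlinarith [hr, ih]
        · have hw : wRow (L := L) lam k1 k2 n = 0 := by
            unfold wRow; rw [if_neg h1, if_neg h2]
          have ht : tSumP L (gPt L la) k1 k2 (n + 1) = tSumP L (gPt L la) k1 k2 n := by
            simp only [tSumP]; rw [if_neg h1, if_neg h2]
          rw [hw, ht]
          nlinarith [ih]

/-- ★ upper bound of the weighted accumulation at `lb`. [folklore] -/
theorem tSumP_upper (hL : 3 ≤ L) (hla : (la : ℝ) ≤ lam * ((D : ℤ) : ℝ)) (hlb : lam * ((D : ℤ) : ℝ) ≤ (lb : ℝ))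
    (hpos : denCellPos L (cosTab L) la lb = true) (hna : gPtNonneg L la = true)
    {k1 k2 : ℕ} (hk1 : k1 < L) (hk2 : k2 < L) :
    ∀ n : ℕ, n ≤ L → (∑ p1 ∈ range n, wRow (L := L) lam k1 k2 p1) * ((D : ℤ) : ℝ) * ((D : ℤ) : ℝ)
      ≤ (((tSumP L (gPt L lb) k1 k2 n).2 : ℤ) : ℝ)
  | 0, _ => by simp [tSumP]
  | n + 1, hn => by
      have ih := tSumP_upper hL hla hlb hpos hna hk1 hk2 n (by omega)
      have hnL : n < L := by omega
      have hsL : (n + L - k1) % L < L := Nat.mod_lt _ (by omega)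
      rw [Finset.sum_range_succ]
      by_cases h1 : n < (k1 + L - n) % L
      · have hw : wRow (L := L) lam k1 k2 n = 2 * rowN (L := L) lam n ((n + L - k1) % L) k2 := by
          unfold wRow; rw [if_pos h1]
        have ht : tSumP L (gPt L lb) k1 k2 (n + 1)
            = ((tSumP L (gPt L lb) k1 k2 n).1 + 2 * (rowCorr L (gPt L lb) n ((n + L - k1) % L) k2 (0, 0)).1,
               (tSumP L (gPt L lb) k1 k2 n).2 + 2 * (rowCorr L (gPt L lb) n ((n + L - k1) % L) k2 (0, 0)).2) := by
          simp only [tSumP]; rw [if_pos h1]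
        have hr := rowCorr_upper hL hla hlb hpos hna hnL hsL hk2 ((0 : ℤ), (0 : ℤ))
        rw [hw, ht]
        push_cast at hr ih ⊢
        nlinarith [hr, ih]
      · by_cases h2 : n = (k1 + L - n) % L
        · have hw : wRow (L := L) lam k1 k2 n = rowN (L := L) lam n ((n + L - k1) % L) k2 := by
            unfold wRow; rw [if_neg h1, if_pos h2]
          have ht : tSumP L (gPt L lb) k1 k2 (n + 1)
              = rowCorr L (gPt L lb) n ((n + L - k1) % L) k2 (tSumP L (gPt L lb) k1 k2 n) := by
            simp only [tSumP]; rw [if_neg h1, if_pos h2]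
          have hr := rowCorr_upper hL hla hlb hpos hna hnL hsL hk2 (tSumP L (gPt L lb) k1 k2 n)
          rw [hw, ht]
          nlinarith [hr, ih]
        · have hw : wRow (L := L) lam k1 k2 n = 0 := by
            unfold wRow; rw [if_neg h1, if_neg h2]
          have ht : tSumP L (gPt L lb) k1 k2 (n + 1) = tSumP L (gPt L lb) k1 k2 n := by
            simp only [tSumP]; rw [if_neg h1, if_neg h2]
          rw [hw, ht]
          nlinarith [ih]

/-! ## From the weighted sum to `T` -/

/-- the row sum at natural coordinates is `rowT`. [folklore] -/
theorem rowT_nat (lam : ℝ) {k1 k2 p1 : ℕ} (hk1 : k1 < L) (hk2 : k2 < L) :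
    rowT L lam ((((k1 : ℕ) : ZMod L)), (((k2 : ℕ) : ZMod L))) ((p1 : ℕ) : ZMod L)
      = rowN (L := L) lam p1 ((p1 + L - k1) % L) k2 := by
  unfold rowT rowN xg
  rw [sum_zmod_natCast]
  refine Finset.sum_congr rfl fun p2 _ => ?_
  congr 2
  ext
  · simp only [Prod.fst_sub]; rw [natCast_shift L hk1]
  · simp only [Prod.snd_sub]; rw [natCast_subm L p2 hk2]

omit [NeZero L] in
/-- the partner map is an involution of `range L`. [folklore] -/
theorem partner_invol {k1 p1 : ℕ} (hp1 : p1 < L) :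
    (k1 + L - (k1 + L - p1) % L) % L = p1 := by
  have hq : (k1 + L - p1) % L < L := Nat.mod_lt _ (by omega)
  have hc : ((((k1 + L - (k1 + L - p1) % L) % L : ℕ)) : ZMod L) = ((p1 : ℕ) : ZMod L) := by
    rw [natCast_partner L hq, natCast_partner L hp1]; ring
  have := (ZMod.natCast_eq_natCast_iff' _ _ L).1 hc
  rwa [Nat.mod_eq_of_lt (Nat.mod_lt _ (by omega)), Nat.mod_eq_of_lt hp1] at this

/-- ★ the weighted sum over `p₁ < L` is `T(k)`. [folklore] -/
theorem sum_wRow_eq_Tsum (lam : ℝ) {k1 k2 : ℕ} (hk1 : k1 < L) (hk2 : k2 < L) :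
    ∑ p1 ∈ range L, wRow (L := L) lam k1 k2 p1 = Tsum L lam ((((k1 : ℕ) : ZMod L)), (((k2 : ℕ) : ZMod L))) := by
  rw [Tsum_eq_rowT, sum_zmod_natCast]
  have h := sum_invol_weight (fun p1 => rowT L lam ((((k1 : ℕ) : ZMod L)), (((k2 : ℕ) : ZMod L))) ((p1 : ℕ) : ZMod L))
    (fun p1 => (k1 + L - p1) % L) L (fun p _ => Nat.mod_lt _ (by omega)) (fun p hp => partner_invol hp)
    (fun p hp => by
      show rowT L lam _ ((((k1 + L - p) % L : ℕ)) : ZMod L) = rowT L lam _ ((p : ℕ) : ZMod L)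
      rw [natCast_partner L hp]
      exact rowT_invol L lam _ _)
  rw [h]
  refine Finset.sum_congr rfl fun p1 _ => ?_
  unfold wRow
  simp only [rowT_nat lam hk1 hk2]

/-- ★ the point entries enclose `T(k)` on the cell: lower end at `la`, upper end at `lb`. [folklore] -/
theorem mem_tEntryP (hL : 3 ≤ L) (hla : (la : ℝ) ≤ lam * ((D : ℤ) : ℝ)) (hlb : lam * ((D : ℤ) : ℝ) ≤ (lb : ℝ))
    (hpos : denCellPos L (cosTab L) la lb = true) (hna : gPtNonneg L la = true)
    {k1 k2 : ℕ} (hk1 : k1 < L) (hk2 : k2 < L) :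
    mem (Tsum L lam ((((k1 : ℕ) : ZMod L)), (((k2 : ℕ) : ZMod L))))
      ((tEntryP L (gPt L la) k1 k2).1, (tEntryP L (gPt L lb) k1 k2).2) := by
  have hD := D_pos
  have hlo := tSumP_lower hL hla hlb hpos hna hk1 hk2 L le_rfl
  have hhi := tSumP_upper hL hla hlb hpos hna hk1 hk2 L le_rfl
  rw [sum_wRow_eq_Tsum lam hk1 hk2] at hlo hhi
  unfold tEntryP roundP mem
  constructor
  · have h1 := ediv_mul_le_real (tSumP L (gPt L la) k1 k2 L).1 D D_pos_int
    simp only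
    nlinarith [h1, hlo]
  · have h1 := le_cdiv_mul_real (tSumP L (gPt L lb) k1 k2 L).2 D D_pos_int
    simp only
    nlinarith [h1, hhi]

end cell

/-! ## The wedge and the cell table -/

omit [NeZero L] in
/-- entries of the point wedge. [folklore] -/
theorem getF_tWedgeP (gm : List (List Iv)) {r1 r2 : ℕ} (hr1 : r1 ≤ L / 2) (hr2 : r2 ≤ r1) :
    getF (tWedgeP L gm) r1 r2 = tEntryP L gm r1 r2 := by
  unfold getF tWedgeP getIv
  rw [getD_map_range _ _ (by omega), getD_map_range _ _ (by omega)]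

omit [NeZero L] in
/-- entries of the cell table. [folklore] -/
theorem getF_tTab2 (tlo thi : List (List Iv)) {k1 k2 : ℕ} (hk1 : k1 < L) (hk2 : k2 < L) :
    getF (tTab2 L tlo thi) k1 k2
      = ((getF tlo (max (fold L k1) (fold L k2)) (min (fold L k1) (fold L k2))).1,
         (getF thi (max (fold L k1) (fold L k2)) (min (fold L k1) (fold L k2))).2) := by
  unfold tTab2
  exact getF_mkTab _ hk1 hk2

/-- ★★ THE CELL TABLE ENCLOSES `T(k) = Σ_p g(p) g(p − k)` for every `λ` of the cell (XB2 analogue of `mem_tTab`). [folklore] -/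
theorem mem_tTab2 (hL : 3 ≤ L) {lam : ℝ} {la lb : ℤ}
    (hla : (la : ℝ) ≤ lam * ((D : ℤ) : ℝ)) (hlb : lam * ((D : ℤ) : ℝ) ≤ (lb : ℝ))
    (hpos : denCellPos L (cosTab L) la lb = true) (hna : gPtNonneg L la = true)
    {k1 k2 : ℕ} (hk1 : k1 < L) (hk2 : k2 < L) :
    mem (∑ p : Tor L, gres L lam p * gres L lam (p - ((((k1 : ℕ) : ZMod L), ((k2 : ℕ) : ZMod L)) : Tor L)))
      (getF (tTab2 L (tWedgePt L la) (tWedgePt L lb)) k1 k2) := by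
  have hL0 : 0 < L := by omega
  rw [getF_tTab2 L _ _ hk1 hk2]
  unfold tWedgePt
  have ha := fold_le hk1
  have hb := fold_le hk2
  have hfa : fold L k1 < L := by have := Nat.div_le_self L 2; omega
  have hfb : fold L k2 < L := by have := Nat.div_le_self L 2; omega
  change mem (Tsum L lam _) _
  rw [← Tsum_natFold L lam hk1 hk2]
  rcases le_total (fold L k2) (fold L k1) with h | h
  · rw [max_eq_left h, min_eq_right h, getF_tWedgeP L _ ha h, getF_tWedgeP L _ ha h]
    exact mem_tEntryP hL hla hlb hpos hna hfa hfb
  · rw [max_eq_right h, min_eq_left h, getF_tWedgeP L _ hb h, getF_tWedgeP L _ hb h,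
      Tsum_natSwap L lam (fold L k2) (fold L k1)]
    exact mem_tEntryP hL hla hlb hpos hna hfb hfa

end FinXB

end Summit.HubbardSuperconductivity.HubbardSuperconductivity.Theorems.AnisotropyChord.Transfer.Fibre3
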